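import Summits.QuantumFields.YangMills.Theorems.LuscherReductionTwistedTraceScalingBORecordGamma
import Summits.QuantumFields.YangMills.Theorems.LuscherReductionTwistedTraceScalingBOBtCPolyFloor
import Summits.QuantumFields.YangMills.Theorems.LuscherReductionTwistedTraceScalingBTTopValue
import HarnessLib

/-!
# (C4-CORE currency, absolute) THE ABSOLUTE CURRENCY FLOOR `c_R·β^{-K}·e^{4β|E|}·‖φ‖² ≤ Λ(β)²·T(φ)`, eventually in `β`
# (lane A of S-BASE, crux `TwistedTraceScaling` stmt-QuantumFields-20203, C4-CORE, the (OD) pen; `pub/ym-fleet/ym-luscher-20007-p1/HANDOFF-g20.md` (β))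

The (OD) assembly `…BODefect.hOD_of_defect` wants the defect bounded by `(b·Λ)²·T`, `Λ = (btC/fpZ/γ)·λ₀(L³β)`, `T = tubeNormSq w (boFun φ Ω_c)`; the three NON-core
pieces of `…BODefectSplit.sq_integral_defect_split_le` (FP tail, outer region, shell of the dual BO function) are bounded ABSOLUTELY by `X_i(β)·‖φ‖²`.  This file converts:
★★ `currency_floor` — there are `c_R > 0`, `K` with, eventually in `β`, for every bounded measurable `φ` supported in `orbitDist < 14β^{-s}/|Site|`,
`c_R·(β^{-1})^K·(e^{2β})^{2|E|}·∫φ² ≤ Λ(β)²·T(φ)`.  Ingredients: `T ≥ (1−C_qδ²)γ‖φ‖²` (`…BORecordGamma.tubeNormSq_record_ge`), `btC ≥ C₁β^{-K₁}`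
(`…BOBtCPolyFloor.btC_record_poly_floor`), `λ₀(B) ≥ e^{6B}e^{-3}B^{-9/2}/2000` (`…BTTopValue.levelValue_one_site_zero_ge`, `e^{6L³β} = (e^{2β})^{|E|}`), `fpZ ≤ 1`,
`γ ≤ N̄(1)·π(univ)` (`recordGamma_eq`, `fpWeightBar_mono`).  Hence each absolute piece is a RATE `b_i² = X_i/(c_Rβ^{-K}e^{4β|E|})`, super-polynomially small for the
pieces of record (`X_i ∝ e^{4β|E|}e^{−cℓ²}`).
HONEST FRAMING: bookkeeping for a stub of a child of the CONDITIONAL route R2b1; the hOD assembly, (B-ST), C4-CORE remain OPEN; not a gap, not Clay.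
-/

set_option autoImplicit false

noncomputable section

open MeasureTheory Filter Topology Real
open scoped BigOperators
open Literature.MathematicalPhysics.QuantumFieldTheory
open Literature.MathematicalPhysics.QuantumLattice

namespace Summit.QuantumFields.YangMills.Theorems.FemtoTransferGap.TwoLattice.ConstTube

open Summit.QuantumFields.YangMills.Theorems.FemtoTransferGap
open Summit.QuantumFields.YangMills.Theorems.FemtoTransferGap.TwoLattice
open Summit.QuantumFields.YangMills.Theorems.FemtoTransferGap.TwoLattice.Avg
open Summit.QuantumFields.YangMills.Theorems.FemtoTransferGap.TwoLattice.Stiff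
open Summit.QuantumFields.YangMills.Theorems.FemtoTransferGap.TwoLattice.GnChart
open Summit.QuantumFields.YangMills.Theorems.FemtoTransferGap.TwoLattice.Cov

variable {L : ℕ} [NeZero L]

/-- `N̄` is monotone in the gauge width on `[0, ∞)`. [folklore] -/
theorem fpWeightBar_mono {s t : ℝ} (hs : 0 ≤ s) (hst : s ≤ t) : fpWeightBar L s ≤ fpWeightBar L t := by
  unfold fpWeightBar
  have hG : 0 < Real.sqrt (gramDet L 0) := Real.sqrt_pos.mpr (gramDet_zero_pos L)
  have hd : (0 : ℝ) ≤ (flatDim L / 2 : ℝ) := by positivity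
  have h1 : (π * s ^ 2) ^ (flatDim L / 2 : ℝ) ≤ (π * t ^ 2) ^ (flatDim L / 2 : ℝ) :=
    Real.rpow_le_rpow (by positivity) (mul_le_mul_of_nonneg_left (pow_le_pow_left₀ hs hst 2) Real.pi_pos.le) hd
  exact div_le_div_of_nonneg_right (mul_le_mul_of_nonneg_left h1 (by positivity)) hG.le

/-- `fpZ ε ≤ 1` (a Haar probability). [folklore] -/
theorem fpZ_le_one (ε : ℝ) : fpZ ε ≤ 1 := by
  haveI : IsProbabilityMeasure (haarProbability SU2) := ⟨by simpa [haarProbability] using Measure.haarMeasure_self (G := SU2) (K₀ := ⊤)⟩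
  unfold fpZ
  calc (haarProbability SU2).real (fpBall ε) ≤ (haarProbability SU2).real Set.univ := measureReal_mono (Set.subset_univ _)
    _ = 1 := probReal_univ

/-- `γ(β) ≤ N̄(1)·π(univ)` for `β` with `powScale 1 β ≤ 1` (always). [folklore] -/
theorem recordGamma_le_fpWeightBar_one (β : ℝ) :
    recordGamma L (fun β' => fun x : LinkSpace L => {x : LinkSpace L | linkCurry x ∈ capBalancedSet L}.indicator (fun _ => (1 : ℝ)) x * frozenProfile L (fun β'' => stiffGaussExp L (β'' / 2) β'') (fun β'' => min (1 / 40) (powScale (1 / 2) β'' * btLog β'')) β' x) β ≤ fpWeightBar L 1 * (orthoTransverse L).real Set.univ := by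
  haveI := isFiniteMeasure_orthoTransverse L
  rw [recordGamma_eq]
  have hN0 : 0 ≤ fpWeightBar L (powScale 1 β) := (fpWeightBar_pos L (powScale_pos 1 β)).le
  have hN1 : fpWeightBar L (powScale 1 β) ≤ fpWeightBar L 1 := fpWeightBar_mono (powScale_pos 1 β).le (powScale_le_one zero_le_one β)
  have hI : ∫ v, {v : Edge 3 L → Fin 3 → ℝ | ‖linkEmbed L v‖ ≤ min (1 / 40) (powScale (1 / 2) β * btLog β)}.indicator (fun _ => (1 : ℝ)) v *
          (Real.exp (-(stiffGaussExp L (β / 2) β (linkEmbed L v))) ^ 2 * Real.exp (-(‖(gaugeModes L).starProjection (linkEmbed L v)‖ ^ 2 / powScale 1 β ^ 2))) ∂orthoTransverse L ≤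
      (orthoTransverse L).real Set.univ := by
    have h1 : ∫ v, {v : Edge 3 L → Fin 3 → ℝ | ‖linkEmbed L v‖ ≤ min (1 / 40) (powScale (1 / 2) β * btLog β)}.indicator (fun _ => (1 : ℝ)) v *
          (Real.exp (-(stiffGaussExp L (β / 2) β (linkEmbed L v))) ^ 2 * Real.exp (-(‖(gaugeModes L).starProjection (linkEmbed L v)‖ ^ 2 / powScale 1 β ^ 2))) ∂orthoTransverse L ≤
        ∫ v, (1 : ℝ) ∂orthoTransverse L := by
      refine integral_mono_of_nonneg (ae_of_all _ fun v => ?_) (integrable_const _) (ae_of_all _ fun v => ?_)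
      · exact mul_nonneg (Set.indicator_nonneg (fun _ _ => zero_le_one) _) (mul_nonneg (sq_nonneg _) (Real.exp_pos _).le)
      · have hi : {v : Edge 3 L → Fin 3 → ℝ | ‖linkEmbed L v‖ ≤ min (1 / 40) (powScale (1 / 2) β * btLog β)}.indicator (fun _ => (1 : ℝ)) v ≤ 1 :=
          Set.indicator_le_self' (fun _ _ => zero_le_one) _
        have he1 : Real.exp (-(stiffGaussExp L (β / 2) β (linkEmbed L v))) ^ 2 ≤ 1 := by
          have h0 := stiffGaussExp_nonneg (L := L) (β / 2) β (linkEmbed L v)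
          have : Real.exp (-(stiffGaussExp L (β / 2) β (linkEmbed L v))) ≤ 1 := Real.exp_le_one_iff.mpr (by linarith)
          exact pow_le_one₀ (Real.exp_pos _).le this
        have he2 : Real.exp (-(‖(gaugeModes L).starProjection (linkEmbed L v)‖ ^ 2 / powScale 1 β ^ 2)) ≤ 1 :=
          Real.exp_le_one_iff.mpr (by have := div_nonneg (sq_nonneg ‖(gaugeModes L).starProjection (linkEmbed L v)‖) (sq_nonneg (powScale 1 β)); linarith)
        calc _ ≤ 1 * (1 * 1) := mul_le_mul hi (mul_le_mul he1 he2 (Real.exp_pos _).le zero_le_one) (mul_nonneg (sq_nonneg _) (Real.exp_pos _).le) zero_le_one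
          _ = 1 := by ring
    rw [integral_const, smul_eq_mul, mul_one] at h1
    exact h1
  have hI0 : 0 ≤ ∫ v, {v : Edge 3 L → Fin 3 → ℝ | ‖linkEmbed L v‖ ≤ min (1 / 40) (powScale (1 / 2) β * btLog β)}.indicator (fun _ => (1 : ℝ)) v *
          (Real.exp (-(stiffGaussExp L (β / 2) β (linkEmbed L v))) ^ 2 * Real.exp (-(‖(gaugeModes L).starProjection (linkEmbed L v)‖ ^ 2 / powScale 1 β ^ 2))) ∂orthoTransverse L :=
    integral_nonneg fun v => mul_nonneg (Set.indicator_nonneg (fun _ _ => zero_le_one) _) (mul_nonneg (sq_nonneg _) (Real.exp_pos _).le)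
  exact mul_le_mul hN1 hI hI0 (fpWeightBar_pos L one_pos).le

/-- `γ(β) > 0` for `β ≥ 0`. [folklore] -/
theorem recordGamma_record_pos {β : ℝ} (hβ0 : 0 ≤ β) : 0 < recordGamma L (fun β' => fun x : LinkSpace L => {x : LinkSpace L | linkCurry x ∈ capBalancedSet L}.indicator (fun _ => (1 : ℝ)) x * frozenProfile L (fun β'' => stiffGaussExp L (β'' / 2) β'') (fun β'' => min (1 / 40) (powScale (1 / 2) β'' * btLog β'')) β' x) β := by
  rw [recordGamma_eq]
  have hNb : 0 < fpWeightBar L (powScale 1 β) := fpWeightBar_pos L (powScale_pos 1 β)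
  have hrf : 0 < min (1 / 40) (powScale (1 / 2) β * btLog β) / 12 :=
    div_pos (lt_min (by norm_num) (mul_pos (powScale_pos _ _) (lt_of_lt_of_le one_pos (one_le_btLog β)))) (by norm_num)
  have hlow' := inner_gauss_mass_ge (L := L) (t := β / 2) (b := β) (s := powScale 1 β) (ρ := min (1 / 40) (powScale (1 / 2) β * btLog β) / 12)
    (R := min (1 / 40) (powScale (1 / 2) β * btLog β)) (by positivity) hβ0 (powScale_pos 1 β) (by linarith [hrf])
  have hball := orthoTransverse_real_ball_ge (L := L) hrf
  have hballpos : 0 < (orthoTransverse L).real {v | ‖linkEmbed L v‖ < min (1 / 40) (powScale (1 / 2) β * btLog β) / 12} :=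
    lt_of_lt_of_le (pow_pos (div_pos (pow_pos (lt_min (by norm_num) (div_pos (pow_pos hrf 2) (by positivity))) 3) (by norm_num)) _) hball
  have hpos : 0 < Real.exp (-((2 * (96 * (β / 2) + β) + 1 / powScale 1 β ^ 2) * (min (1 / 40) (powScale (1 / 2) β * btLog β) / 12) ^ 2)) *
      (orthoTransverse L).real {v | ‖linkEmbed L v‖ < min (1 / 40) (powScale (1 / 2) β * btLog β) / 12} :=
    mul_pos (Real.exp_pos _) hballpos
  exact mul_pos hNb (lt_of_lt_of_le hpos hlow')

/-- `(e^{2β})^{|E|} = e^{6L³β}`. [folklore] -/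
theorem exp_two_pow_card_edge (β : ℝ) : Real.exp (2 * β) ^ Fintype.card (Edge 3 L) = Real.exp (6 * ((L : ℝ) ^ 3 * β)) := by
  rw [← Real.exp_nat_mul, card_edge_three]; ring_nf

/-- Pure algebra of the floor: a product of four nonnegative lower bounds. [folklore] -/
theorem currency_floor_alg {btC C₁K lam lamF Z γ G T I : ℝ} (hC₁K : 0 ≤ C₁K) (hbtC : C₁K ≤ btC) (hlamF : 0 ≤ lamF) (hlam : lamF ≤ lam)
    (hZ0 : 0 < Z) (hZ1 : Z ≤ 1) (hγ0 : 0 < γ) (hγG : γ ≤ G) (hI : 0 ≤ I) (hT : 1 / 2 * γ * I ≤ T) :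
    C₁K ^ 2 * lamF ^ 2 / (2 * G) * I ≤ (btC / Z / γ * lam) ^ 2 * T := by
  have hG0 : 0 < G := lt_of_lt_of_le hγ0 hγG
  have h1 : C₁K ^ 2 ≤ btC ^ 2 := pow_le_pow_left₀ hC₁K hbtC 2
  have h2 : lamF ^ 2 ≤ lam ^ 2 := pow_le_pow_left₀ hlamF hlam 2
  have h3 : 1 / (2 * G) ≤ 1 / (2 * γ) := one_div_le_one_div_of_le (by positivity) (by linarith)
  have h4 : (1 : ℝ) ≤ 1 / Z ^ 2 := by
    rw [le_div_iff₀ (by positivity), one_mul]; exact pow_le_one₀ hZ0.le hZ1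
  have hbtC0 : 0 ≤ btC := hC₁K.trans hbtC
  have hprod : C₁K ^ 2 * lamF ^ 2 * (1 / (2 * G)) * 1 ≤ btC ^ 2 * lam ^ 2 * (1 / (2 * γ)) * (1 / Z ^ 2) :=
    mul_le_mul (mul_le_mul (mul_le_mul h1 h2 (sq_nonneg _) (sq_nonneg _)) h3 (by positivity) (by positivity)) h4 zero_le_one (by positivity)
  have hΛ : btC ^ 2 * lam ^ 2 * (1 / (2 * γ)) * (1 / Z ^ 2) * I = (btC / Z / γ * lam) ^ 2 * (1 / 2 * γ * I) := by
    field_simp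
  calc C₁K ^ 2 * lamF ^ 2 / (2 * G) * I = C₁K ^ 2 * lamF ^ 2 * (1 / (2 * G)) * 1 * I := by ring
    _ ≤ btC ^ 2 * lam ^ 2 * (1 / (2 * γ)) * (1 / Z ^ 2) * I := mul_le_mul_of_nonneg_right hprod hI
    _ = (btC / Z / γ * lam) ^ 2 * (1 / 2 * γ * I) := hΛ
    _ ≤ (btC / Z / γ * lam) ^ 2 * T := mul_le_mul_of_nonneg_left hT (sq_nonneg _)

set_option maxHeartbeats 800000 in
-- long record expressions.
/-- ★★ **THE ABSOLUTE CURRENCY FLOOR** (see the module docstring): `∃ M₀ ≥ 2, ∀ M ≥ M₀, ∃ c_R > 0, ∃ K, ∀ᶠ β, ∀ φ …, c_R·(β^{-1})^K·((e^{2β})^{|E|})²·∫φ² ≤ Λ(β)²·T(φ)`.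
[cite: Luscher1983, §3] -/
theorem currency_floor (hLz : Nonempty (NzSite L)) {s : ℝ} (hs : 0 < s) (hs3 : s ≤ 1 / 3) :
    ∃ M₀ : ℝ, 2 ≤ M₀ ∧ ∀ M : ℝ, M₀ ≤ M → ∃ (cR : ℝ) (K : ℕ), 0 < cR ∧ ∀ᶠ β : ℝ in atTop,
      ∀ φ : GaugeConfig 3 1 SU2 → ℝ, Measurable φ → ∀ Cφ : ℝ, (∀ u, |φ u| ≤ Cφ) → (∀ u, φ u ≠ 0 → orbitDist u < 14 * powScale s β / Fintype.card (Site 3 L)) →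
      cR * powScale 1 β ^ K * (Real.exp (2 * β) ^ Fintype.card (Edge 3 L)) ^ 2 * ∫ u, φ u ^ 2 ∂configMeasure SU2 1 ≤
        (btC L β (fun x : LinkSpace L => {x : LinkSpace L | linkCurry x ∈ capBalancedSet L}.indicator (fun _ => (1 : ℝ)) x * frozenProfile L (fun β' => stiffGaussExp L (β' / 2) β') (fun β' => min (1 / 40) (powScale (1 / 2) β' * btLog β')) β x) (powScale 1 β) (5 * (powScale (1 / 2) β * btLog β ^ 2)) / fpZ (powScale 1 β) / recordGamma L (fun β' => fun x : LinkSpace L => {x : LinkSpace L | linkCurry x ∈ capBalancedSet L}.indicator (fun _ => (1 : ℝ)) x * frozenProfile L (fun β'' => stiffGaussExp L (β'' / 2) β'') (fun β'' => min (1 / 40) (powScale (1 / 2) β'' * btLog β'')) β' x) β *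
          levelValue su2Rep 1 ((L : ℝ) ^ 3 * β) 0) ^ 2 * tubeNormSq (softWeight (recordChi L s 43 M β)) (boFun L φ (fun x : LinkSpace L => {x : LinkSpace L | linkCurry x ∈ capBalancedSet L}.indicator (fun _ => (1 : ℝ)) x * frozenProfile L (fun β' => stiffGaussExp L (β' / 2) β') (fun β' => min (1 / 40) (powScale (1 / 2) β' * btLog β')) β x)) := by
  haveI := isFiniteMeasure_orthoTransverse L
  obtain ⟨M₀, hM₀, hnorm⟩ := tubeNormSq_record_ge (L := L) hLz hs hs3
  refine ⟨M₀, hM₀, fun M hM => ?_⟩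
  obtain ⟨Cq, hCq, hn⟩ := hnorm M hM
  obtain ⟨C₁, K₁, hC₁, hbtC⟩ := btC_record_poly_floor (L := L)
  set G : ℝ := fpWeightBar L 1 * (orthoTransverse L).real Set.univ + 1 with hGdef
  have hG0 : 0 < G := by
    have : 0 ≤ fpWeightBar L 1 * (orthoTransverse L).real Set.univ := mul_nonneg (fpWeightBar_pos L one_pos).le measureReal_nonneg
    rw [hGdef]; linarith
  have hL1 : (1 : ℝ) ≤ L := by exact_mod_cast NeZero.one_le
  have hL3 : (1 : ℝ) ≤ (L : ℝ) ^ 3 := one_le_pow₀ hL1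
  refine ⟨C₁ ^ 2 * (Real.exp (-3) / 2000) ^ 2 / ((L : ℝ) ^ 3) ^ 9 / (2 * G), 2 * K₁ + 9, by positivity, ?_⟩
  have hrs := rStar_pos
  -- the eventual conditions: the btC floor, `C_q δ² ≤ 1/2`, `β ≥ 1`, `β ≥ 2/rStar³`
  have eCq : ∀ᶠ β : ℝ in atTop, Cq * (43 * powScale s β) ^ 2 ≤ 1 / 2 := by
    have h := ((tendsto_powScale hs).const_mul 43).pow 2 |>.const_mul Cq
    rw [mul_zero, zero_pow two_ne_zero, mul_zero] at h
    exact h.eventually (eventually_le_nhds (by norm_num))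
  filter_upwards [hn, hbtC, eCq, eventually_ge_atTop (1 : ℝ), eventually_ge_atTop (2 / rStar ^ 3)] with β hnβ' hbtCβ hCqβ hβ1 hβr φ hφm Cφ hCφ hφs
  obtain ⟨-, hnβ⟩ := hnβ'
  have hβ0 : 0 ≤ β := by linarith
  -- the data
  set B : ℝ := (L : ℝ) ^ 3 * β with hBdef
  have hB1 : 1 ≤ B := by rw [hBdef]; nlinarith
  have hB2 : 2 / rStar ^ 3 ≤ B := by
    rw [hBdef]; have : 0 ≤ 2 / rStar ^ 3 := by positivity
    nlinarith
  have hB0 : 0 < B := by linarith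
  have hlam := levelValue_one_site_zero_ge hB1 hB2
  have hZ0 : 0 < fpZ (powScale 1 β) := fpZ_pos (powScale_pos 1 β)
  have hZ1 := fpZ_le_one (powScale 1 β)
  have hγ0 := recordGamma_record_pos (L := L) hβ0
  have hγG : recordGamma L (fun β' => fun x : LinkSpace L => {x : LinkSpace L | linkCurry x ∈ capBalancedSet L}.indicator (fun _ => (1 : ℝ)) x * frozenProfile L (fun β'' => stiffGaussExp L (β'' / 2) β'') (fun β'' => min (1 / 40) (powScale (1 / 2) β'' * btLog β'')) β' x) β ≤ G := by
    have := recordGamma_le_fpWeightBar_one (L := L) β; rw [hGdef]; linarith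
  have hI : 0 ≤ ∫ u, φ u ^ 2 ∂configMeasure SU2 1 := integral_nonneg fun u => sq_nonneg _
  have hT : 1 / 2 * recordGamma L (fun β' => fun x : LinkSpace L => {x : LinkSpace L | linkCurry x ∈ capBalancedSet L}.indicator (fun _ => (1 : ℝ)) x * frozenProfile L (fun β'' => stiffGaussExp L (β'' / 2) β'') (fun β'' => min (1 / 40) (powScale (1 / 2) β'' * btLog β'')) β' x) β * ∫ u, φ u ^ 2 ∂configMeasure SU2 1 ≤ tubeNormSq (softWeight (recordChi L s 43 M β)) (boFun L φ (fun x : LinkSpace L => {x : LinkSpace L | linkCurry x ∈ capBalancedSet L}.indicator (fun _ => (1 : ℝ)) x * frozenProfile L (fun β' => stiffGaussExp L (β' / 2) β') (fun β' => min (1 / 40) (powScale (1 / 2) β' * btLog β')) β x)) := by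
    have h := hnβ φ hφm Cφ hCφ hφs
    have h2 : 1 / 2 * recordGamma L (fun β' => fun x : LinkSpace L => {x : LinkSpace L | linkCurry x ∈ capBalancedSet L}.indicator (fun _ => (1 : ℝ)) x * frozenProfile L (fun β'' => stiffGaussExp L (β'' / 2) β'') (fun β'' => min (1 / 40) (powScale (1 / 2) β'' * btLog β'')) β' x) β * ∫ u, φ u ^ 2 ∂configMeasure SU2 1 ≤
        (1 - Cq * (43 * powScale s β) ^ 2) * recordGamma L (fun β' => fun x : LinkSpace L => {x : LinkSpace L | linkCurry x ∈ capBalancedSet L}.indicator (fun _ => (1 : ℝ)) x * frozenProfile L (fun β'' => stiffGaussExp L (β'' / 2) β'') (fun β'' => min (1 / 40) (powScale (1 / 2) β'' * btLog β'')) β' x) β * ∫ u, φ u ^ 2 ∂configMeasure SU2 1 := by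
      have := mul_le_mul_of_nonneg_right (mul_le_mul_of_nonneg_right (show (1 : ℝ) / 2 ≤ 1 - Cq * (43 * powScale s β) ^ 2 by linarith) hγ0.le) hI
      exact this
    exact h2.trans h
  have hps1 : powScale 1 β = β⁻¹ := by rw [powScale_eq hβ1, Real.rpow_neg_one]
  -- the floor of `λ₀`: `e^{6B}e^{-3}B^{-9/2}/2000`, squared `= (e^{2β})^{2|E|}·(e^{-3}/2000)²·β^{-9}/L^{27}`
  have hlamF0 : 0 ≤ Real.exp (6 * B) * (Real.exp (-3) * B ^ (-(9 : ℝ) / 2) / 2000) :=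
    mul_nonneg (Real.exp_pos _).le (div_nonneg (mul_nonneg (Real.exp_pos _).le (Real.rpow_nonneg hB0.le _)) (by norm_num))
  have hC₁K : 0 ≤ C₁ * powScale 1 β ^ K₁ := mul_nonneg hC₁.le (pow_nonneg (powScale_pos 1 β).le _)
  have key := currency_floor_alg hC₁K hbtCβ hlamF0 hlam hZ0 hZ1 hγ0 hγG hI hT
  -- identify the left-hand sides
  have hBpow : (B ^ (-(9 : ℝ) / 2)) ^ 2 = powScale 1 β ^ 9 / ((L : ℝ) ^ 3) ^ 9 := by
    rw [← Real.rpow_natCast, ← Real.rpow_mul hB0.le]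
    norm_num
    rw [hps1, hBdef]
    field_simp
  have hE : Real.exp (6 * B) = Real.exp (2 * β) ^ Fintype.card (Edge 3 L) := by rw [exp_two_pow_card_edge]
  have hlhs : C₁ ^ 2 * (Real.exp (-3) / 2000) ^ 2 / ((L : ℝ) ^ 3) ^ 9 / (2 * G) * powScale 1 β ^ (2 * K₁ + 9) * (Real.exp (2 * β) ^ Fintype.card (Edge 3 L)) ^ 2 *
        ∫ u, φ u ^ 2 ∂configMeasure SU2 1 =
      (C₁ * powScale 1 β ^ K₁) ^ 2 * (Real.exp (6 * B) * (Real.exp (-3) * B ^ (-(9 : ℝ) / 2) / 2000)) ^ 2 / (2 * G) * ∫ u, φ u ^ 2 ∂configMeasure SU2 1 := by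
    have e1 : (Real.exp (6 * B) * (Real.exp (-3) * B ^ (-(9 : ℝ) / 2) / 2000)) ^ 2 =
        (Real.exp (2 * β) ^ Fintype.card (Edge 3 L)) ^ 2 * (Real.exp (-3) / 2000) ^ 2 * (B ^ (-(9 : ℝ) / 2)) ^ 2 := by rw [hE]; ring
    rw [e1, hBpow, pow_add, pow_mul]
    field_simp
    ring
  rw [hlhs]
  exact key

end Summit.QuantumFields.YangMills.Theorems.FemtoTransferGap.TwoLattice.ConstTube

end
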